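import Literature.Computability.AlgebraicComplexity.MS21ANFSeparation
import Literature.Computability.AlgebraicComplexity.MS21ANFBlockSupport
import HarnessLib

/-!
# Medini–Shpilka 2021, §5: the second derivatives of the canonical ROANF `ANF_Δ` are equal or
# monomially disjoint (toolkit for the characteristic-free form of Lemma 5.13, registry B36)

Theorem-only toolkit file (seat x5 g3, owner of the `MS2021_thm_35` route) = stage S2 of seat t18 g5's
blueprint `np/t18g5-MS21-thm35-B36-hasse-blueprint.md` for the characteristic-free replacement of
[MediniShpilka2021, Lemma 5.13] (its contrapositive is the hypothesis `h513H` of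
`MS2021.thm35Core_of_bricks_hasse`, `MS21ANFThm35HasseBranch`).  The blueprint's step (b):

> "The family `{∂_i∂_j ANF : non-sibling ×-pairs} ∪ {∂_Q ANF : quadratics Q}` is linearly independent,
> with `∂_i∂_{i^s} ANF = ∂_{i'}∂_{i'^s} ANF =: ∂_Q ANF` for the two pairs of one quadratic and NO other
> coincidence: a monomial `μ` of `∂_i∂_j ANF` is an ANF-transversal minus `{i,j}` …"

is recorded here WITHOUT naming siblings or quadratics (no definitions, no new named facts, D-0026):

* `disjoint_support_pderiv_anf` — **first derivatives of `ANF_Δ` along different variables have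
  disjoint monomial sets** (a transversal minus one leaf remembers the leaf);
* `pderiv_pderiv_anf_succ_cases` — the three shapes of `∂_i∂_j ANF_{Δ+1}` in block coordinates
  (zero across the top addition gate; `ANF_Δ(x^{(sib b)}) · (∂∂ANF_Δ)(x^{(b)})` inside one block;
  `(∂ANF_Δ)(x^{(sib b)}) · (∂ANF_Δ)(x^{(b)})` across sibling blocks — seat p1 g5's
  `pderiv_pderiv_anf_succ_same/_sib/_other`);
* `pderiv_pderiv_anf_eq_or_disjoint` — **any two second partial derivatives of `ANF_Δ` are either
  EQUAL or have DISJOINT supports** (induction on `Δ` by block-degree profiles, seat t24 g5's block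
  support calculus `MS21ANFBlockSupport` for the equal-profile cases; the only coincidences are the
  printed ones: inside a block by induction, and at the bottom level the two sibling pairs of one
  quadratic, `∂_{x₁}∂_{x₀} ANF₁ = ∂_{x₃}∂_{x₂} ANF₁ = 1`);
* `coeff_sum_C_mul_pderiv_pderiv_anf` — consequently a combination `Σ_{i,j} β_{ij} ∂_i∂_j ANF_Δ`
  has, at a monomial of `∂_{i₀}∂_{j₀} ANF_Δ ≠ 0`, the coefficient `(Σ_{(i,j) : ∂_i∂_j ANF = ∂_{i₀}∂_{j₀} ANF} β_{ij})
  · coeff`, and `sum_eq_zero_of_sum_C_mul_pderiv_pderiv_anf_eq_zero`: if the combination vanishes,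
  every such class sum of coefficients vanishes (the linear independence modulo the coincidences).

HONEST FRAMING: toolkit toward the all-characteristics form of Lemma 5.13 / `MS2021_thm_35`; `VP ≠ VNP`
is NOT proved and nothing here bears on it.

## References
* [MediniShpilka2021] D. Medini, A. Shpilka, CCC 2021 (LIPIcs 200:19) = arXiv:2102.05632: Obs 5.8
  (p0025:L57–L60), ‹obs:monRoanf›, Lemma 5.13 (p0029:L3–L13), Def 8.
-/

noncomputable section

open MvPolynomial

namespace Literature.Computability.AlgebraicComplexity

namespace MS2021

/-! ### Block degrees of monomials of block products -/

section BlockDegree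

variable {K : Type*} [Field K]

/-- Block degree of a monomial supported in one renamed block. [folklore] -/
private theorem blockSum_of_mem_support_rename' {Δ : ℕ} (b b' : Fin 4)
    {p : MvPolynomial (Fin (4 ^ Δ)) K} {ν : Fin (4 ^ (Δ + 1)) →₀ ℕ}
    (hν : ν ∈ (rename (anfBlock Δ b) p).support) :
    ∃ ν' ∈ p.support, (∑ j, ν (anfBlock Δ b' j)) = if b' = b then ν'.degree else 0 := by
  classical
  rw [support_rename_of_injective (anfBlock_injective Δ b)] at hν
  obtain ⟨ν', hν', rfl⟩ := Finset.mem_image.1 hν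
  refine ⟨ν', hν', ?_⟩
  by_cases hb : b' = b
  · subst hb
    rw [if_pos rfl]
    simp_rw [Finsupp.mapDomain_apply (anfBlock_injective Δ b')]
    rw [Finsupp.degree_eq_sum]
  · rw [if_neg hb]
    refine Finset.sum_eq_zero fun j _ => ?_
    rw [Finsupp.mapDomain_notin_range]
    rintro ⟨j', h⟩
    exact hb (anfBlock_inj h).1.symm

/-- **Block-degree profile of a block product**: a monomial of `P(x^{(a)}) · Q(x^{(b)})` with `P, Q`
homogeneous of degrees `dp, dq` has degree `dp` in block `a`, `dq` in block `b`, `0` elsewhere.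
[cite: MediniShpilka2021, Obs 5.8 (arXiv p0025:L57–L60)] -/
theorem blockSum_of_mem_support_blockMul {Δ dp dq : ℕ} {a b : Fin 4}
    {P Q : MvPolynomial (Fin (4 ^ Δ)) K} (hP : P.IsHomogeneous dp) (hQ : Q.IsHomogeneous dq)
    (b' : Fin 4) {ν : Fin (4 ^ (Δ + 1)) →₀ ℕ}
    (hν : ν ∈ (rename (anfBlock Δ a) P * rename (anfBlock Δ b) Q).support) :
    (∑ j, ν (anfBlock Δ b' j)) = (if b' = a then dp else 0) + (if b' = b then dq else 0) := by
  classical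
  obtain ⟨α, hα, β, hβ, rfl⟩ := Finset.mem_add.1 (support_mul _ _ hν)
  obtain ⟨α', hα', hαsum⟩ := blockSum_of_mem_support_rename' (K := K) a b' hα
  obtain ⟨β', hβ', hβsum⟩ := blockSum_of_mem_support_rename' (K := K) b b' hβ
  have hαdeg : α'.degree = dp := (hP.degree_eq_sum_deg_support hα').symm
  have hβdeg : β'.degree = dq := (hQ.degree_eq_sum_deg_support hβ').symm
  simp only [Finsupp.coe_add, Pi.add_apply, Finset.sum_add_distrib, hαsum, hβsum, hαdeg, hβdeg]

/-- The sibling block is another block; no block is its own sibling's sibling-complement. [folklore] -/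
private theorem one_sub_ne (b : Fin 4) : (1 - b : Fin 4) ≠ b := by
  fin_cases b <;> decide

end BlockDegree

/-! ### First derivatives: different variables, disjoint monomials -/

section First

variable (K : Type*) [Field K]

/-- `∂ANF_0/∂x = 1`. [cite: MediniShpilka2021, Def 8 (arXiv p0025:L31)] -/
theorem pderiv_anf_zero (a : Fin (4 ^ 0)) : pderiv a (anf K 0) = 1 := by
  have ha : a = ⟨0, by norm_num⟩ := by
    ext; have := a.2; simp only [pow_zero] at this; simp only; omega
  subst ha
  simp only [anf, pderiv_X_self]

/-- **First derivatives of `ANF_Δ` along different variables have disjoint monomial sets** (a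
monomial of `∂ANF/∂x_a` is an ANF-transversal minus the leaf `a`, which it determines).
[cite: MediniShpilka2021, Obs 5.8 and ‹obs:monRoanf› (arXiv p0025:L57–L60)] -/
theorem disjoint_support_pderiv_anf : ∀ (Δ : ℕ) (a c : Fin (4 ^ Δ)), a ≠ c →
    Disjoint (pderiv a (anf K Δ)).support (pderiv c (anf K Δ)).support
  | 0, a, c, hac => by
    exfalso
    apply hac
    ext; have := a.2; have := c.2; simp only [pow_zero] at *; omega
  | Δ + 1, x, y, hxy => by
    classical
    obtain ⟨b, a, rfl⟩ := exists_eq_anfBlock Δ x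
    obtain ⟨b', c, rfl⟩ := exists_eq_anfBlock Δ y
    have h1b := one_sub_ne b
    have hpow := Nat.one_le_two_pow (n := Δ)
    rw [Finset.disjoint_left]
    intro m hm hm'
    rw [pderiv_anf_succ] at hm hm'
    by_cases hbb : b' = b
    · subst hbb
      have hac : a ≠ c := fun h => hxy (by rw [h])
      obtain ⟨m₁, -, m₂, hm₂, rfl⟩ := (mem_support_rename_anfBlock_mul_iff Δ h1b _ _).1 hm
      obtain ⟨n₁, -, n₂, hn₂, heq⟩ := (mem_support_rename_anfBlock_mul_iff Δ h1b _ _).1 hm'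
      obtain ⟨-, rfl⟩ := (mapDomain_anfBlock_add_eq_add_iff Δ h1b _ _ _ _).1 heq
      exact Finset.disjoint_left.1 (disjoint_support_pderiv_anf Δ a c hac) hm₂ hn₂
    · have e1 := blockSum_of_mem_support_blockMul (isHomogeneous_anf K Δ)
        (isHomogeneous_pderiv_anf K Δ a) (1 - b) hm
      have e2 := blockSum_of_mem_support_blockMul (isHomogeneous_anf K Δ)
        (isHomogeneous_pderiv_anf K Δ c) (1 - b) hm'
      rw [if_pos rfl, if_neg h1b] at e1
      by_cases hbs : b' = 1 - b
      · subst hbs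
        rw [sub_sub_cancel, if_neg h1b, if_pos rfl] at e2
        omega
      · have hne1 : (1 - b : Fin 4) ≠ 1 - b' := fun h => hbb (sub_right_injective h).symm
        have hne2 : (1 - b : Fin 4) ≠ b' := fun h => hbs h.symm
        rw [if_neg hne1, if_neg hne2] at e2
        omega

end First

/-! ### Second derivatives: the three shapes at level `Δ + 1`, and equal-or-disjoint -/

section Second

variable (K : Type*) [Field K]

/-- All second derivatives of `ANF_0 = x` vanish. [cite: MediniShpilka2021, Def 8 (arXiv p0025:L31)] -/
theorem pderiv_pderiv_anf_zero (i j : Fin (4 ^ 0)) : pderiv i (pderiv j (anf K 0)) = 0 := by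
  rw [pderiv_anf_zero, pderiv_one]

/-- **The three shapes of `∂_i∂_j ANF_{Δ+1}`** in block coordinates: zero (first common gate is the
top addition gate), `ANF_Δ(x^{(sib b)}) · (∂_{a₂}∂_a ANF_Δ)(x^{(b)})` (both variables in block `b`),
or `(∂_{a₂}ANF_Δ)(x^{(sib b)}) · (∂_a ANF_Δ)(x^{(b)})` (sibling blocks).
[cite: MediniShpilka2021, Obs 5.8 (arXiv p0025:L57–L60)] -/
theorem pderiv_pderiv_anf_succ_cases (Δ : ℕ) (i j : Fin (4 ^ (Δ + 1))) :
    pderiv i (pderiv j (anf K (Δ + 1))) = 0 ∨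
    (∃ (b : Fin 4) (a₂ a : Fin (4 ^ Δ)), i = anfBlock Δ b a₂ ∧ j = anfBlock Δ b a ∧
      pderiv i (pderiv j (anf K (Δ + 1))) =
        rename (anfBlock Δ (1 - b)) (anf K Δ) *
          rename (anfBlock Δ b) (pderiv a₂ (pderiv a (anf K Δ)))) ∨
    (∃ (b : Fin 4) (a₂ a : Fin (4 ^ Δ)), i = anfBlock Δ (1 - b) a₂ ∧ j = anfBlock Δ b a ∧
      pderiv i (pderiv j (anf K (Δ + 1))) =
        rename (anfBlock Δ (1 - b)) (pderiv a₂ (anf K Δ)) *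
          rename (anfBlock Δ b) (pderiv a (anf K Δ))) := by
  obtain ⟨b, a, rfl⟩ := exists_eq_anfBlock Δ j
  obtain ⟨b₂, a₂, rfl⟩ := exists_eq_anfBlock Δ i
  by_cases h1 : b₂ = b
  · subst h1
    exact Or.inr (Or.inl ⟨b₂, a₂, a, rfl, rfl, pderiv_pderiv_anf_succ_same K Δ b₂ a a₂⟩)
  · by_cases h2 : b₂ = 1 - b
    · subst h2
      exact Or.inr (Or.inr ⟨b, a₂, a, rfl, rfl, pderiv_pderiv_anf_succ_sib K Δ b a a₂⟩)
    · exact Or.inl (pderiv_pderiv_anf_succ_other K Δ h1 h2 a a₂)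

variable {K}

/-- Second derivatives of `ANF_Δ` are homogeneous of degree `2^Δ - 1 - 1`. [folklore] -/
private theorem isHomogeneous_pderiv_pderiv_anf (Δ : ℕ) (a₂ a : Fin (4 ^ Δ)) :
    (pderiv a₂ (pderiv a (anf K Δ))).IsHomogeneous (2 ^ Δ - 1 - 1) :=
  (isHomogeneous_pderiv_anf K Δ a).pderiv

/-- Profile contradiction: "same-block" shape at `b` against anything whose block-`(1-b)` degree is
not `2^Δ`. [folklore] -/
private theorem blockSum_same {Δ : ℕ} (b : Fin 4) (a₂ a : Fin (4 ^ Δ))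
    {ν : Fin (4 ^ (Δ + 1)) →₀ ℕ}
    (hν : ν ∈ (rename (anfBlock Δ (1 - b)) (anf K Δ) *
      rename (anfBlock Δ b) (pderiv a₂ (pderiv a (anf K Δ)))).support) (b' : Fin 4) :
    (∑ j, ν (anfBlock Δ b' j)) =
      (if b' = 1 - b then 2 ^ Δ else 0) + (if b' = b then 2 ^ Δ - 1 - 1 else 0) :=
  blockSum_of_mem_support_blockMul (isHomogeneous_anf K Δ) (isHomogeneous_pderiv_pderiv_anf Δ a₂ a)
    b' hν

/-- Block-degree profile of the "sibling" shape: `2^Δ - 1` in blocks `b` and `sib b`. [folklore] -/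
private theorem blockSum_sib {Δ : ℕ} (b : Fin 4) (a₂ a : Fin (4 ^ Δ))
    {ν : Fin (4 ^ (Δ + 1)) →₀ ℕ}
    (hν : ν ∈ (rename (anfBlock Δ (1 - b)) (pderiv a₂ (anf K Δ)) *
      rename (anfBlock Δ b) (pderiv a (anf K Δ))).support) (b' : Fin 4) :
    (∑ j, ν (anfBlock Δ b' j)) =
      (if b' = 1 - b then 2 ^ Δ - 1 else 0) + (if b' = b then 2 ^ Δ - 1 else 0) :=
  blockSum_of_mem_support_blockMul (isHomogeneous_pderiv_anf K Δ a₂) (isHomogeneous_pderiv_anf K Δ a)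
    b' hν

variable (K)

/-- **Any two second partial derivatives of `ANF_Δ` are equal or have disjoint monomial sets** —
the blueprint's "NO other coincidence": the only equalities between NONZERO second derivatives are
`∂_i∂_j = ∂_j∂_i`, the ones inherited inside a block, and, at the bottom, the two sibling pairs of
one quadratic (`∂_{x₁}∂_{x₀}(x₀x₁ + x₂x₃) = ∂_{x₃}∂_{x₂}(x₀x₁ + x₂x₃) = 1`).
[cite: MediniShpilka2021, Obs 5.8 and ‹obs:monRoanf› (arXiv p0025:L57–L60); proof of Lemma 5.14 ("if `x_ix_j + x_{i'}x_{j'}` is a quadratic form of ANF then `∂²ANF/∂x_i∂x_j = ∂²ANF/∂x_{i'}∂x_{j'}`", p0029:L40–L44)] -/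
theorem pderiv_pderiv_anf_eq_or_disjoint : ∀ (Δ : ℕ) (i j i' j' : Fin (4 ^ Δ)),
    pderiv i (pderiv j (anf K Δ)) = pderiv i' (pderiv j' (anf K Δ)) ∨
    Disjoint (pderiv i (pderiv j (anf K Δ))).support (pderiv i' (pderiv j' (anf K Δ))).support
  | 0, i, j, i', j' => Or.inl (by rw [pderiv_pderiv_anf_zero, pderiv_pderiv_anf_zero])
  | Δ + 1, i, j, i', j' => by
    classical
    have hpow := Nat.one_le_two_pow (n := Δ)
    rcases pderiv_pderiv_anf_succ_cases K Δ i j with h0 | ⟨b, a₂, a, rfl, rfl, hD⟩ |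
        ⟨b, a₂, a, rfl, rfl, hD⟩
    · right
      rw [h0, support_zero]
      exact Finset.disjoint_empty_left _
    · -- `D` has the same-block shape at `b`
      rcases pderiv_pderiv_anf_succ_cases K Δ i' j' with h0' | ⟨c, e₂, e, rfl, rfl, hD'⟩ |
          ⟨c, e₂, e, rfl, rfl, hD'⟩
      · right
        rw [h0', support_zero]
        exact Finset.disjoint_empty_right _
      · -- same / same
        by_cases hcb : c = b
        · subst hcb
          rcases pderiv_pderiv_anf_eq_or_disjoint Δ a₂ a e₂ e with heq | hdis
          · left
            rw [hD, hD', heq]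
          · right
            rw [hD, hD', Finset.disjoint_left]
            intro m hm hm'
            obtain ⟨m₁, -, m₂, hm₂, rfl⟩ :=
              (mem_support_rename_anfBlock_mul_iff Δ (one_sub_ne c) _ _).1 hm
            obtain ⟨n₁, -, n₂, hn₂, heq⟩ :=
              (mem_support_rename_anfBlock_mul_iff Δ (one_sub_ne c) _ _).1 hm'
            obtain ⟨-, rfl⟩ := (mapDomain_anfBlock_add_eq_add_iff Δ (one_sub_ne c) _ _ _ _).1 heq
            exact Finset.disjoint_left.1 hdis hm₂ hn₂
        · right
          rw [hD, hD', Finset.disjoint_left]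
          intro m hm hm'
          have e1 := blockSum_same b a₂ a hm (1 - b)
          have e2 := blockSum_same c e₂ e hm' (1 - b)
          rw [if_pos rfl, if_neg (one_sub_ne b)] at e1
          by_cases hcb' : c = 1 - b
          · subst hcb'
            rw [sub_sub_cancel, if_neg (one_sub_ne b), if_pos rfl] at e2
            omega
          · have hne1 : (1 - b : Fin 4) ≠ 1 - c := fun h => hcb (sub_right_injective h).symm
            have hne2 : (1 - b : Fin 4) ≠ c := fun h => hcb' h.symm
            rw [if_neg hne1, if_neg hne2] at e2
            omega
      · -- same / sib
        right
        rw [hD, hD', Finset.disjoint_left]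
        intro m hm hm'
        have e1 := blockSum_same b a₂ a hm (1 - b)
        have e2 := blockSum_sib c e₂ e hm' (1 - b)
        rw [if_pos rfl, if_neg (one_sub_ne b)] at e1
        have hcc : c ≠ 1 - c := fun h => one_sub_ne c h.symm
        split_ifs at e2 with h1 h2 h2
        · exact hcc (h2.symm.trans h1)
        · omega
        · omega
        · omega
    · -- `D` has the sibling shape at `b`
      rcases pderiv_pderiv_anf_succ_cases K Δ i' j' with h0' | ⟨c, e₂, e, rfl, rfl, hD'⟩ |
          ⟨c, e₂, e, rfl, rfl, hD'⟩
      · right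
        rw [h0', support_zero]
        exact Finset.disjoint_empty_right _
      · -- sib / same
        right
        rw [hD, hD', Finset.disjoint_left]
        intro m hm hm'
        have e1 := blockSum_sib b a₂ a hm (1 - c)
        have e2 := blockSum_same c e₂ e hm' (1 - c)
        rw [if_pos rfl, if_neg (one_sub_ne c)] at e2
        have hbb : b ≠ 1 - b := fun h => one_sub_ne b h.symm
        split_ifs at e1 with h1 h2 h2
        · exact hbb (h2.symm.trans h1)
        · omega
        · omega
        · omega
      · -- sib / sib
        by_cases hcb : c = b
        · subst hcb
          by_cases hidx : a₂ = e₂ ∧ a = e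
          · obtain ⟨rfl, rfl⟩ := hidx
            left
            rfl
          · right
            rw [hD, hD', Finset.disjoint_left]
            intro m hm hm'
            obtain ⟨m₁, hm₁, m₂, hm₂, rfl⟩ :=
              (mem_support_rename_anfBlock_mul_iff Δ (one_sub_ne c) _ _).1 hm
            obtain ⟨n₁, hn₁, n₂, hn₂, heq⟩ :=
              (mem_support_rename_anfBlock_mul_iff Δ (one_sub_ne c) _ _).1 hm'
            obtain ⟨rfl, rfl⟩ := (mapDomain_anfBlock_add_eq_add_iff Δ (one_sub_ne c) _ _ _ _).1 heq
            by_cases h₂ : a₂ = e₂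
            · have hae : a ≠ e := fun h => hidx ⟨h₂, h⟩
              exact Finset.disjoint_left.1 (disjoint_support_pderiv_anf K Δ a e hae) hm₂ hn₂
            · exact Finset.disjoint_left.1 (disjoint_support_pderiv_anf K Δ a₂ e₂ h₂) hm₁ hn₁
        · by_cases hcb' : c = 1 - b
          · subst hcb'
            -- `D' = (∂_{e₂})(x^{(b)}) (∂_e)(x^{(1-b)})`: compare with the factors swapped
            have hD'' : pderiv (anfBlock Δ (1 - (1 - b)) e₂) (pderiv (anfBlock Δ (1 - b) e)
                (anf K (Δ + 1))) =
                rename (anfBlock Δ (1 - b)) (pderiv e (anf K Δ)) *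
                  rename (anfBlock Δ b) (pderiv e₂ (anf K Δ)) := by
              rw [hD', sub_sub_cancel, mul_comm]
            by_cases hidx : a₂ = e ∧ a = e₂
            · obtain ⟨rfl, rfl⟩ := hidx
              left
              rw [hD, hD'']
            · right
              rw [hD, hD'', Finset.disjoint_left]
              intro m hm hm'
              obtain ⟨m₁, hm₁, m₂, hm₂, rfl⟩ :=
                (mem_support_rename_anfBlock_mul_iff Δ (one_sub_ne b) _ _).1 hm
              obtain ⟨n₁, hn₁, n₂, hn₂, heq⟩ :=
                (mem_support_rename_anfBlock_mul_iff Δ (one_sub_ne b) _ _).1 hm'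
              obtain ⟨rfl, rfl⟩ :=
                (mapDomain_anfBlock_add_eq_add_iff Δ (one_sub_ne b) _ _ _ _).1 heq
              by_cases h₂ : a₂ = e
              · have hae : a ≠ e₂ := fun h => hidx ⟨h₂, h⟩
                exact Finset.disjoint_left.1 (disjoint_support_pderiv_anf K Δ a e₂ hae) hm₂ hn₂
              · exact Finset.disjoint_left.1 (disjoint_support_pderiv_anf K Δ a₂ e h₂) hm₁ hn₁
          · -- disjoint sibling pairs of blocks: at `Δ = 0` the two quadratic coincidences
            -- (`∂∂ = 1 = ∂∂`), otherwise disjoint by block degree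
            cases Δ with
            | zero =>
              left
              rw [hD, hD', pderiv_anf_zero, pderiv_anf_zero, pderiv_anf_zero, pderiv_anf_zero,
                map_one, map_one, map_one, map_one]
            | succ Δ =>
              right
              rw [hD, hD', Finset.disjoint_left]
              intro m hm hm'
              have e1 := blockSum_sib b a₂ a hm (1 - b)
              have e2 := blockSum_sib c e₂ e hm' (1 - b)
              rw [if_pos rfl, if_neg (one_sub_ne b)] at e1
              have hne1 : (1 - b : Fin 4) ≠ 1 - c := fun h => hcb (sub_right_injective h).symm
              have hne2 : (1 - b : Fin 4) ≠ c := fun h => hcb' h.symm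
              rw [if_neg hne1, if_neg hne2] at e2
              have : 1 ≤ 2 ^ Δ := Nat.one_le_two_pow
              have h2 : 2 ^ (Δ + 1) = 2 ^ Δ * 2 := pow_succ 2 Δ
              omega

/-! ### Coefficient reading: independence modulo the coincidences -/

/-- **Coefficient of a combination of second derivatives at a monomial of one of them**: only the
second derivatives EQUAL to `∂_{i₀}∂_{j₀} ANF` contribute.
[cite: MediniShpilka2021, proof of Lemma 5.14 (arXiv p0029:L40–L44)] -/
theorem coeff_sum_C_mul_pderiv_pderiv_anf [DecidableEq K] (Δ : ℕ) (β : Fin (4 ^ Δ) → Fin (4 ^ Δ) → K)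
    (i₀ j₀ : Fin (4 ^ Δ)) {m₀ : Fin (4 ^ Δ) →₀ ℕ}
    (hm₀ : m₀ ∈ (pderiv i₀ (pderiv j₀ (anf K Δ))).support) :
    coeff m₀ (∑ i, ∑ j, C (β i j) * pderiv i (pderiv j (anf K Δ))) =
      (∑ i, ∑ j, if pderiv i (pderiv j (anf K Δ)) = pderiv i₀ (pderiv j₀ (anf K Δ)) then β i j
        else 0) * coeff m₀ (pderiv i₀ (pderiv j₀ (anf K Δ))) := by
  rw [coeff_sum, Finset.sum_mul]
  refine Finset.sum_congr rfl fun i _ => ?_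
  rw [coeff_sum, Finset.sum_mul]
  refine Finset.sum_congr rfl fun j _ => ?_
  rw [coeff_C_mul]
  split_ifs with h
  · rw [h]
  · rcases pderiv_pderiv_anf_eq_or_disjoint K Δ i j i₀ j₀ with heq | hdis
    · exact absurd heq h
    · rw [notMem_support_iff.1 (Finset.disjoint_right.1 hdis hm₀), mul_zero, zero_mul]

/-- **Linear independence modulo the coincidences**: if `Σ_{i,j} β_{ij} ∂_i∂_j ANF_Δ = 0` then for
every nonzero `∂_{i₀}∂_{j₀} ANF_Δ` the coefficients of the second derivatives equal to it sum to
`0`. [cite: MediniShpilka2021, proof of Lemma 5.14 (arXiv p0029:L40–L44); Obs 5.8] -/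
theorem sum_eq_zero_of_sum_C_mul_pderiv_pderiv_anf_eq_zero [DecidableEq K] (Δ : ℕ)
    (β : Fin (4 ^ Δ) → Fin (4 ^ Δ) → K)
    (hβ : (∑ i, ∑ j, C (β i j) * pderiv i (pderiv j (anf K Δ))) = 0)
    (i₀ j₀ : Fin (4 ^ Δ)) (h₀ : pderiv i₀ (pderiv j₀ (anf K Δ)) ≠ 0) :
    (∑ i, ∑ j, if pderiv i (pderiv j (anf K Δ)) = pderiv i₀ (pderiv j₀ (anf K Δ)) then β i j
      else 0) = 0 := by
  obtain ⟨m₀, hm₀⟩ := Finset.nonempty_iff_ne_empty.2 (fun h => h₀ (support_eq_empty.1 h))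
  have key := coeff_sum_C_mul_pderiv_pderiv_anf K Δ β i₀ j₀ hm₀
  rw [hβ, coeff_zero] at key
  exact (mul_eq_zero.1 key.symm).resolve_right (mem_support_iff.1 hm₀)

end Second

end MS2021

end Literature.Computability.AlgebraicComplexity

end
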